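import Literature.NumberTheory.Automorphic.Liu2021.AppendixC.HeckeTraceWordPieces
import Literature.NumberTheory.Automorphic.Liu2021.AppendixC.JacobianFanPullbackWordDeck
import HarnessLib

/-!
# The trace word of the level cover `u : X_N → X_K` in matrix form is DECK INVARIANT at the Y-level (`u^* ≫ δ_* = u^*`;
# Lang VIII §6 Thm. 13; LR22 Prop. 3.5.1) — the `hWd` input of the transposed Hecke word

Topic `NumberTheory/Automorphic/Liu2021/AppendixC`; namespace `Literature.NumberTheory.Automorphic.Liu2021.AppendixC.Sec42Data.HeckeTranslates`.
PROOF FILE (theorems only; no definition, no named fact, no instance, no `sorry`).  Sequel of ★ `HeckeTraceWordPieces` ((P-ii) the trace word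
`Wt = Σ_{c′} πY_K (bN c′) ≫ (m c′ • ttH c′) ≫ ιY_N c′` with `Wt ≫ v_N = v_K ≫ t_ℂ`) and ★ `JacobianFanPullbackWordDeck` (`Wt ≫ W_d = Wt` generically).
Setting and notation as there ([Liu2021] §4.2 tower `C`, `[Algebra E ℂ]`, levels `N ≤ K`, the finite deck action `act : Δ →* Aut X_N` with `u`
a quotient for separated test objects, the Albanese trace `t` pinned by `act`, the piecewise complex models with fans `π/ι` and the piece
maps `tu` of `u_ℂ`).

* **`exists_fan_traceWord_deck`** — ★ `exists_fan_traceWord` (per piece `c′`: `H c′ ≤ Aut (E_N c′)` finite with `tu c′` a quotient, the pinned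
  pull-back `ttH c′`, the multiplicity `m c′ ≥ 1`; `Wt ≫ v_N = v_K ≫ t_ℂ`) for the SAME witnesses PLUS, for every `δ ∈ Δ` and every lift
  family `cs : C_N → C_N`, `dk c : E_N c → E_N (cs c)` of `(act δ)_ℂ` (`dk c ≫ eN (cs c) = eN c ≫ (act δ)_ℂ`):
  **`Wt ≫ (Σ_c πY_N c ≫ Nm_{dk c} ≫ ιY_N (cs c)) = Wt`** — verbatim the hypothesis `hWd` of ★ `HeckeEndomorphismTransposedWordScalar` §Section and
  ★ `fan_entry_deck_invariant` (with `cs := (d • ·)`, `dk := dk d`, the ambient `Tκ d := (act δ_d)_ℂ`: the `T_γ`-fixing deck transformations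
  are translates `T_k`, `k ∈ K`, i.e. elements of the deck group of `u`).

Cell `hodgecm-mathlib` (D-0151), crux `HLiu418` = stmt-HodgeConjecture-24832, d6 line, `stub_RosH` glue, sockets (G3)+`hWd` of the frame's
`slot_letters` (A-p16 (g13) hand-off «(P-ii) + hWd», A-p02 (g14) (L) pen).  COUNT-NEUTRAL capital: HC_CM is proved only modulo the 7 printed
citations until rung 0 closes; nothing here discharges a binder.

## References
* [Liu2021] Y. Liu, *Fourier–Jacobi cycles and arithmetic relative trace formula*, Camb. J. Math. 9 (2021): §4.2 (FJcycle.tex l. 2070–2074),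
  p. 133 (before (D.3)).
* [Lang1983AbelianVarieties] S. Lang, *Abelian Varieties* (1983), Ch. VIII §6 Thm. 13 (pp. 224–227).
* [LangeRodriguez2022] H. Lange, R. E. Rodríguez, *Decomposition of Jacobians by Prym Varieties*, LNM 2310 (2022), §3.5.1 Prop. 3.5.1 (p. 65).
* [Milne2005ShimuraVarieties] J. S. Milne, *Introduction to Shimura varieties* (2005), §5 p. 57 L7–12, Rem. 5.29 (c) p. 65.
* [MumfordAV1970] D. Mumford, *Abelian Varieties* (1970), §7 Thm. p. 66 and Remark.
-/

set_option autoImplicit false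

noncomputable section

open CategoryTheory CategoryTheory.Limits AlgebraicGeometry MonoidalCategory CartesianMonoidalCategory NumberField
open Literature.AlgebraicGeometry.Motives

namespace Literature.NumberTheory.Automorphic.Liu2021.AppendixC

section Sec42

open AbelianVariety (bcSpec bcFunctor)

-- `(A.baseChange L).X` is `(bcFunctor E L).obj A.X` only up to unfolding `AbelianVariety.baseChange` (as in ★ `HeckeEndomorphismComplexWord`)
set_option backward.isDefEq.respectTransparency false

variable {F E : Type} [Field F] [NumberField F] [IsTotallyReal F] [Field E] [NumberField E] [Algebra F E]
  [IsTotallyComplex E] [Algebra.IsQuadraticExtension F E]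
variable {P5 : PropC5Data F E} {isotropicAt : ℕ → Prop}

namespace Sec42Data.HeckeTranslates

variable {C : Sec42Data P5 isotropicAt} [Algebra E ℂ]
variable {N K : C5.SmallLevel C.S.K₀}
-- piecewise model of `A_N ⊗ ℂ`, with its fan `πN/ιN`
variable {CN : Type} [Fintype CN] (EN : CN → SchemeOver ℂ) (eN : ∀ c, EN c ⟶ (bcFunctor E ℂ).obj (C.X N))
  (JN : ∀ c, Jacobian (EN c)) (YN : AbelianVariety ℂ) (πN : ∀ c, YN ⟶ (JN c).J) (ιN : ∀ c, (JN c).J ⟶ YN)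
  (vN : YN ⟶ (C.A N).baseChange ℂ) (lN : ∀ c, EN c ⊗ EN c ⟶ (bcFunctor E ℂ).obj (C.alb N).nabla.N)
-- piecewise model of `A_K ⊗ ℂ`, with its fan `πK/ιK`
variable {CK : Type} [Fintype CK] (EK : CK → SchemeOver ℂ) (eK : ∀ c, EK c ⟶ (bcFunctor E ℂ).obj (C.X K))
  (JK : ∀ c, Jacobian (EK c)) (YK : AbelianVariety ℂ) (πK : ∀ c, YK ⟶ (JK c).J) (ιK : ∀ c, (JK c).J ⟶ YK)
  (vK : YK ⟶ (C.A K).baseChange ℂ) (lK : ∀ c, EK c ⊗ EK c ⟶ (bcFunctor E ℂ).obj (C.alb K).nabla.N)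

/-- **(P-ii) THE TRACE WORD OF THE LEVEL COVER IN MATRIX FORM, WITH ITS DECK INVARIANCE `hWd`** (d6 `stub_RosH` glue, socket (G3) of the
frame's `slot_letters`; = ★ `exists_fan_traceWord` for the SAME witnesses plus the last conjunct).
Data: small levels `N ≤ K`; the level projection `u : X_N → X_K` realised as a quotient of `X_N` by a FINITE group `act : Δ →* Aut X_N` for
separated test objects ([Milne2005ShimuraVarieties] §5 «`Sh_K = Sh_{K′}/(K/K′)`»; ★ `exists_finite_isSepQuotient_map'`); an Albanese trace
`t : A_K → A_N` of `u` pinned by the deck group, `Alb_u ≫ t = Σ_δ Alb(act δ)` ([Lang1983AbelianVarieties] VIII §6 Thm. 13; ★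
`Albanese.exists_trace_of_isSepQuotient_complex`); piecewise complex models of `A_N ⊗ ℂ`, `A_K ⊗ ℂ` (smooth projective curves
`E_• c → X_• ⊗ ℂ` forming colimit cofans, Jacobians, biproduct fans `π/ι` on `Y_•`, comparison maps `v_•`, `α`-compatibilities — the
`GSComplexModel` fields); the piece maps `tu c′ : E_N c′ → E_K (bN c′)` of `u_ℂ`.  THEN for every piece `c′` there are: the finite group
`H c′ ≤ Aut (E_N c′)` of lifts of its stabiliser, for which `tu c′` IS A QUOTIENT for separated test objects (the `Hu`/`hqu` input of ★
`Jacobian.exists_entry_levelAdjoint`); the pinned pull-back `ttH c′` (`Nm_{tu c′} ≫ ttH c′ = Σ_{h ∈ H c′} h_*`, its `tt`/`htt` input); a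
multiplicity `m c′ ≥ 1` (`= #ker(Stab_Δ(c′) → Aut (E_N c′))`; `= 1` iff `K/N` acts piecewise faithfully); and THE TRACE WORD INTERTWINES `t`:
**`(Σ_{c′} πY_K (bN c′) ≫ (m c′ • ttH c′) ≫ ιY_N c′) ≫ v_N = v_K ≫ t_ℂ`** — the `(bN, tt := m • ttH, hWt)` input of ★
`algEquiv_symm_endAlgebraBaseChange_heckeEnd_eq_smul_fan_sum`; AND the DECK INVARIANCE of that word at the Y-level: for every `δ ∈ Δ` and
every lift family `cs : C_N → C_N`, `dk c : E_N c → E_N (cs c)` of `(act δ)_ℂ` through the pieces,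
**`(Σ_{c′} πY_K (bN c′) ≫ (m c′ • ttH c′) ≫ ιY_N c′) ≫ (Σ_c πY_N c ≫ Nm_{dk c} ≫ ιY_N (cs c)) = Σ_{c′} πY_K (bN c′) ≫ (m c′ • ttH c′) ≫ ιY_N c′`** —
the `hWd` input of ★ `HeckeEndomorphismTransposedWordScalar` / ★ `fan_entry_deck_invariant` (there `cs := (d • ·)`, `Tκ d := (act δ_d)_ℂ`).  Proof:
★ `Jacobian.exists_fan_pullback_word_deck` on `u_ℂ` and the cancellation argument of ★ `trace_baseChange_word_of_cancel` ([LangeRodriguez2022]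
Prop. 3.5.1: `u^* ≫ δ_* = u^*`).
[cite: Lang1983AbelianVarieties, Ch. VIII §6, Thm. 13 (pp. 224–227)] [cite: LangeRodriguez2022, §3.5.1 Prop. 3.5.1 (p. 65)]
[cite: Liu2021, §4.2 (FJcycle.tex l. 2070–2074) and p. 133 (before (D.3))] [cite: Milne2005ShimuraVarieties, §5 p. 57 L7–12 and Rem. 5.29 (c) p. 65]
[cite: MumfordAV1970, §7 Thm. p. 66 and Remark] -/
theorem exists_fan_traceWord_deck (h : N ≤ K)
    {Δ : Type} [Group Δ] [Fintype Δ] (act : Δ →* Aut (C.X N))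
    (hp : IsSepQuotient (fun δ => act δ) (C.cpt.X.map (homOfLE h)))
    (t : C.A K ⟶ C.A N)
    (ht : (C.alb N).map (C.alb K) (C.cpt.X.map (homOfLE h)) ≫ t = ∑ δ, (C.alb N).map (C.alb N) (act δ).hom)
    (hcN : IsColimit (Cofan.mk ((bcFunctor E ℂ).obj (C.X N)) eN)) (hEN : ∀ c, IsSmoothProjective 1 (EN c))
    (hcK : IsColimit (Cofan.mk ((bcFunctor E ℂ).obj (C.X K)) eK)) (hEK : ∀ c, IsSmoothProjective 1 (EK c))
    (htotN : ∑ c, πN c ≫ ιN c = 𝟙 YN) (hιπN : ∀ c, ιN c ≫ πN c = 𝟙 _) (hιπN' : ∀ c₁ c₂, c₁ ≠ c₂ → ιN c₁ ≫ πN c₂ = 0)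
    (htotK : ∑ c, πK c ≫ ιK c = 𝟙 YK) (hιπK : ∀ c, ιK c ≫ πK c = 𝟙 _) (hιπK' : ∀ c₁ c₂, c₁ ≠ c₂ → ιK c₁ ≫ πK c₂ = 0)
    (hlN : ∀ c, lN c ≫ (bcFunctor E ℂ).map (C.alb N).nabla.incl = (eN c ⊗ₘ eN c) ≫ Functor.LaxMonoidal.μ (bcFunctor E ℂ) (C.X N) (C.X N))
    (hlαN : ∀ c, lN c ≫ (bcFunctor E ℂ).map (C.alb N).α = (JN c).diff ≫ (ιN c ≫ vN).hom.hom.hom)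
    (hlK : ∀ c, lK c ≫ (bcFunctor E ℂ).map (C.alb K).nabla.incl = (eK c ⊗ₘ eK c) ≫ Functor.LaxMonoidal.μ (bcFunctor E ℂ) (C.X K) (C.X K))
    (hlαK : ∀ c, lK c ≫ (bcFunctor E ℂ).map (C.alb K).α = (JK c).diff ≫ (ιK c ≫ vK).hom.hom.hom)
    (bN : CN → CK) (tu : ∀ c', EN c' ⟶ EK (bN c'))
    (htu : ∀ c', tu c' ≫ eK (bN c') = eN c' ≫ (bcFunctor E ℂ).map (C.cpt.X.map (homOfLE h))) :
    ∃ (H : ∀ c', Subgroup (Aut (EN c'))) (_ : ∀ c', Finite ↥(H c'))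
      (_ : ∀ c', IsSepQuotient (fun h : ↥(H c') => (h : Aut (EN c'))) (tu c'))
      (ttH : ∀ c', (JK (bN c')).J ⟶ (JN c').J) (m : CN → ℕ),
      (∀ c', 0 < m c') ∧
      (∀ c', haveI := Fintype.ofFinite ↥(H c');
        (JN c').pushforward (JK (bN c')) (tu c') ≫ ttH c' =
          ∑ h : ↥(H c'), (JN c').pushforward (JN c') (h : Aut (EN c')).hom) ∧
      (∑ c', πK (bN c') ≫ ((m c' : ℤ) • ttH c') ≫ ιN c') ≫ vN = vK ≫ AbelianVariety.Hom.baseChange ℂ t ∧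
      (∀ (δ : Δ) (cs : CN → CN) (dk : ∀ c, EN c ⟶ EN (cs c)),
        (∀ c, dk c ≫ eN (cs c) = eN c ≫ (bcFunctor E ℂ).map (act δ).hom) →
        (∑ c', πK (bN c') ≫ ((m c' : ℤ) • ttH c') ≫ ιN c') ≫
            (∑ c, πN c ≫ (JN c).pushforward (JN (cs c)) (dk c) ≫ ιN (cs c)) =
          ∑ c', πK (bN c') ≫ ((m c' : ℤ) • ttH c') ≫ ιN c') := by
  classical
  haveI : ∀ c, IsIntegral (EN c).left := fun c => IsSmoothProjective.isIntegral_holds (hEN c)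
  -- the complexified deck action and quotient
  let actC : Δ →* Aut ((bcFunctor E ℂ).obj (C.X N)) :=
    { toFun := fun δ => (bcFunctor E ℂ).mapIso (act δ)
      map_one' := by rw [map_one]; exact (bcFunctor E ℂ).mapIso_refl _
      map_mul' := fun a b => by rw [map_mul]; exact (bcFunctor E ℂ).mapIso_trans (act b) (act a) }
  have hactC : ∀ δ, (actC δ).hom = (bcFunctor E ℂ).map (act δ).hom := fun δ => rfl
  have hXK : IsSeparated (C.X K).hom := by haveI := (C.cpt.projective_X K).isProper; infer_instance
  obtain ⟨hXsep, hpC⟩ := isSepQuotient_baseChangeHom_of_isProjectiveOver E (algebraMap E ℂ) Δ (C.X N) (C.X K)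
    (C.cpt.projective_X N) act (C.cpt.X.map (homOfLE h)) hXK hp
  have hpC' : IsSepQuotient (fun δ => actC δ) ((bcFunctor E ℂ).map (C.cpt.X.map (homOfLE h))) := hpC
  have hXsep' : IsSeparated ((bcFunctor E ℂ).obj (C.X K)).hom := hXsep
  have hX'proj : IsProjectiveOver ((bcFunctor E ℂ).obj (C.X N)) := (C.cpt.projective_X N).baseChange_obj (L := ℂ)
  -- piece lifts of the deck automorphisms
  have hl := fun δ c₁ => exists_pieceLift actC eN hcN δ c₁
  choose φδ tδ htδ using hl
  -- §1 on the complexified cover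
  obtain ⟨H, hfin, hq, ttH, m, hm, httH, hpinY, hcancel, hdeck⟩ :=
    Jacobian.exists_fan_pullback_word_deck actC ((bcFunctor E ℂ).map (C.cpt.X.map (homOfLE h))) EN eN JN EK eK JK bN tu πN ιN πK ιK
      hιπN hιπN' htotK hιπK hιπK' hX'proj hXsep' hpC' hcN hEN hcK hEK htu φδ tδ htδ
  refine ⟨H, hfin, hq, ttH, m, hm, httH, hcancel ?_, fun δ cs dk hdk => hdeck δ cs dk hdk⟩
  -- the deck words intertwine the Albanese maps (N1), the trace word is pinned (§1), cancel the word of `u`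
  have hWu := map_baseChange_word EN eN JN YN πN ιN vN lN EK eK JK YK ιK vK lK htotN hlN hlαN hlK hlαK
    (C.cpt.X.map (homOfLE h)) bN tu htu
  have hWδ : ∀ δ, vN ≫ AbelianVariety.Hom.baseChange ℂ ((C.alb N).map (C.alb N) (act δ).hom) =
      (∑ c', πN c' ≫ (JN c').pushforward (JN (φδ δ c')) (tδ δ c') ≫ ιN (φδ δ c')) ≫ vN := fun δ =>
    map_baseChange_word EN eN JN YN πN ιN vN lN EN eN JN YN ιN vN lN htotN hlN hlαN hlN hlαN (act δ).hom (φδ δ) (tδ δ)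
      (htδ δ)
  have hsum : vN ≫ AbelianVariety.Hom.baseChange ℂ (∑ δ, (C.alb N).map (C.alb N) (act δ).hom) =
      (∑ δ, ∑ c', πN c' ≫ (JN c').pushforward (JN (φδ δ c')) (tδ δ c') ≫ ιN (φδ δ c')) ≫ vN := by
    have e1 : AbelianVariety.Hom.baseChange ℂ (∑ δ, (C.alb N).map (C.alb N) (act δ).hom) =
        ∑ δ, AbelianVariety.Hom.baseChange ℂ ((C.alb N).map (C.alb N) (act δ).hom) :=
      map_sum (AddMonoidHom.mk' (fun g : C.A N ⟶ C.A N => AbelianVariety.Hom.baseChange ℂ g)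
        (AbelianVariety.Hom.baseChange_add ℂ)) _ _
    rw [e1, Preadditive.comp_sum, Preadditive.sum_comp]
    exact Finset.sum_congr rfl fun δ _ => hWδ δ
  rw [← Category.assoc, hpinY, ← hsum, ← ht, AbelianVariety.Hom.baseChange_comp, ← Category.assoc, hWu, Category.assoc]

end Sec42Data.HeckeTranslates

end Sec42

end Literature.NumberTheory.Automorphic.Liu2021.AppendixC

end
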